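import Mathlib
import Summits.Ventures.HSemireg.ContractionSpanAlgebra
import Summits.Ventures.HSemireg.ContractionSpanFactor

/-!
# Venture HSemireg — the carrier bridge (1/3): ⋀(L × Ann L) acting on ⋀V; socle lemma; freeness; S₂ = ContractionSpan.span

HONEST FRAMING. Part of the Lean index of the computation cell `pub-hsemireg` (seat p3; Sunday enclosure of the
FORMULA-N kernel assets of seats th-7 / th-6, ENCLOSURE-PLAN-p3.md).  Finite-dimensional exterior algebra over a field ONLY:
no variety, no cohomology theory, no semiregularity map is constructed here; nothing here says that HC / HC_CM / HC_AV holds;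
no Literature fact is declared or used.  The geometric DICTIONARY (why these ranks are the `HT`-side box ranks of the cell's
STRUCTURE.md §1 / theory/FORMULA-N.md) lives in theory/FORMULA-N-th7.md PART B §A.3 / §N and is NOT asserted in Lean.

th-7's p4-CARRIER BRIDGE (theory/th7/CarrierBridge.lean v2 sha256/16 993195f303c63fcb, §1–§3; FORMULA-N PART B §N.5 /
§N.10), VERBATIM up to the namespace (`HSemiregBridge` ↦ `Summit.Ventures.HSemireg.WedgeBridge`), file 1 of 3: for a subspace
`L ≤ V`, `W := L × Ann L` and `𝒜 := ⋀W` act on `⋀V` by `op (ℓ, θ) = ℓ ∧ − + θ ⌟ −` (`contractLeft`); `op² = 0`, so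
`ρ : ⋀W → End(⋀V)` (`ExteriorAlgebra.lift`); `Φ_ω a := ρ a ω` is `𝒜`-linear and `S k x := ρ(⋀^k W) · x` satisfies
`S_Φ_eq : S k (Φ_ω v) = Φ_ω (range (θ ↦ θ ∧ v on ⋀^k W))` — the WEDGE MODEL of `WedgeKunneth` / `WedgeHankel*` /
`WedgePair*` is the regular representation of `𝒜` transported by `Φ_ω`; the SOCLE LEMMA `exists_mul_eq_top` gives
`Φ_injective_of_top`; the dimension count `Φ_bijective_of_top` / `Φequiv` (⋀V is the free rank-one ⋀W-module); hence
`finrank_S_eq_wedge`; and **`S_two_eq : S 2 x = ContractionSpan.span L (L.dualAnnihilator) x`** LITERALLY (the tree's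
contraction carrier of seat p4, `ContractionSpanAlgebra.lean`).  No permutation sign, no Hodge star, no basis of `V`.
th-7's LEAN NOTES (v2 header): keep the operator sections under `[CommRing K]`; `unfold ρ; simp only [lift_ι_apply]` instead of
`exact ExteriorAlgebra.lift_ι_apply …` at `End(⋀V)`; `obtain ⟨bW⟩ : Nonempty (Basis …)` instead of a `let`-bound `finBasis`.
-/

open Module
open CliffordAlgebra (contractLeft)
open ExteriorAlgebra (ι)

namespace Summit.Ventures.HSemireg.WedgeBridge

/-! ### 1. The socle lemma in an exterior algebra with a finite basis -/

section Socle

variable {K : Type*} [Field K] {M : Type*} [AddCommGroup M] [Module K M]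
variable {I : Type*} [LinearOrder I] [Fintype I] (bM : Basis I K M)

open Set Set.powersetCard

/-- the monomial basis of `Λ M`. -/
noncomputable abbrev BB : Basis (Finset I) K (ExteriorAlgebra K M) := bM.ExteriorAlgebra

/-- structure constants: a unit if disjoint, else `0` (values never used). -/
noncomputable def u (s t : Finset I) : K :=
  if h : Disjoint s t then
    (((powersetCard.permOfDisjoint (s := ⟨s, by rw [mem_iff]⟩) (t := ⟨t, by rw [mem_iff]⟩) h).sign : ℤ) : K)
  else 0

omit [Fintype I] in
/-- the structure constant `u s t` is non-zero iff the supports `s`, `t` are disjoint. -/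
lemma u_ne_zero_iff {s t : Finset I} : u (K := K) s t ≠ 0 ↔ Disjoint s t := by
  have hu : ∀ x : ℤˣ, ((x : ℤ) : K) ≠ 0 := fun x hx => by
    have h2 : ((x : ℤ) : K) * ((x : ℤ) : K) = 1 := by
      rw [← Int.cast_mul, ← Units.val_mul, Int.units_mul_self, Units.val_one, Int.cast_one]
    rw [hx, mul_zero] at h2
    exact zero_ne_one h2
  unfold u
  split_ifs with h
  · exact ⟨fun _ => h, fun _ => hu _⟩
  · simp [h]

omit [Fintype I] in
/-- the structure constant of two overlapping monomials vanishes. -/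
lemma u_eq_zero {s t : Finset I} (h : ¬ Disjoint s t) : u (K := K) s t = 0 := by
  rw [u, dif_neg h]

omit [Fintype I] in
/-- product of two basis monomials: structure constant times the union monomial. -/
lemma BB_mul_BB (s t : Finset I) : BB bM s * BB bM t = u (K := K) s t • BB bM (s ∪ t) := by
  by_cases h : Disjoint s t
  · have h1 := ExteriorAlgebra.basis_mul_of_disjoint bM ⟨s, by rw [mem_iff]⟩ ⟨t, by rw [mem_iff]⟩ h
    rw [coe_disjUnion, Finset.disjUnion_eq_union] at h1
    change BB bM s * BB bM t = _ at h1
    rw [h1, u, dif_pos h, Units.smul_def, ← Int.cast_smul_eq_zsmul K]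
  · have h1 := ExteriorAlgebra.basis_mul_of_not_disjoint bM ⟨s, by rw [mem_iff]⟩ ⟨t, by rw [mem_iff]⟩ h
    change BB bM s * BB bM t = 0 at h1
    rw [h1, u_eq_zero h, zero_smul]

/-- **SOCLE LEMMA.** Every non-zero `a ∈ Λ M` is carried by some left multiplication onto the top monomial. -/
theorem exists_mul_eq_top {a : ExteriorAlgebra K M} (ha : a ≠ 0) :
    ∃ c : ExteriorAlgebra K M, c * a = BB bM Finset.univ := by
  classical
  set S := ((BB bM).repr a).support with hSdef
  have hS : S.Nonempty := by
    rw [hSdef, Finsupp.support_nonempty_iff]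
    intro h
    exact ha ((BB bM).repr.map_eq_zero_iff.mp h)
  obtain ⟨s₀, hs₀, hmin⟩ := S.exists_min_image Finset.card hS
  have hc₀ : (BB bM).repr a s₀ ≠ 0 := Finsupp.mem_support_iff.mp hs₀
  have hu₀ : u (K := K) s₀ᶜ s₀ ≠ 0 := (u_ne_zero_iff).mpr disjoint_compl_left
  refine ⟨((BB bM).repr a s₀ * u (K := K) s₀ᶜ s₀)⁻¹ • BB bM s₀ᶜ, ?_⟩
  have key : BB bM s₀ᶜ * a = ((BB bM).repr a s₀ * u (K := K) s₀ᶜ s₀) • BB bM Finset.univ := by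
    conv_lhs => rw [← (BB bM).sum_repr a]
    rw [Finset.mul_sum]
    simp_rw [mul_smul_comm, BB_mul_BB]
    rw [Finset.sum_eq_single s₀]
    · rw [smul_smul, Finset.union_comm, Finset.union_compl]
    · intro s _ hs
      by_cases hrs : (BB bM).repr a s = 0
      · rw [hrs, zero_smul]
      · have hsS : s ∈ S := Finsupp.mem_support_iff.mpr hrs
        have hcard : s₀.card ≤ s.card := hmin s hsS
        have hnd : ¬ Disjoint s₀ᶜ s := by
          intro hd
          have hsub : s ⊆ s₀ := by
            intro i hi
            by_contra hi0
            exact Finset.disjoint_left.mp hd (Finset.mem_compl.mpr hi0) hi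
          exact hs (Finset.eq_of_subset_of_card_le hsub hcard)
        rw [u_eq_zero hnd, zero_smul, smul_zero]
    · intro h; exact (h (Finset.mem_univ _)).elim
  rw [smul_mul_assoc, key, smul_smul, inv_mul_cancel₀ (mul_ne_zero hc₀ hu₀), one_smul]

/-- Consequence: a linear map out of `Λ M` compatible with SOME left action in the sense
`f (c * a) = g c (f a)` is injective as soon as it does not kill the top monomial. -/
theorem injective_of_map_top_ne_zero {N : Type*} [AddCommGroup N] [Module K N]
    (f : ExteriorAlgebra K M →ₗ[K] N) (g : ExteriorAlgebra K M → N → N) (hg0 : ∀ c, g c 0 = 0)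
    (hfg : ∀ c a, f (c * a) = g c (f a)) (htop : f (BB bM Finset.univ) ≠ 0) :
    Function.Injective f := by
  rw [← LinearMap.ker_eq_bot, LinearMap.ker_eq_bot']
  intro a hfa
  by_contra ha
  obtain ⟨c, hc⟩ := exists_mul_eq_top bM ha
  apply htop
  rw [← hc, hfg, hfa, hg0]

end Socle

/-! ### 2. The operator algebra `𝒜 = Λ(L × Ann L)` acting on `Λ V`, the orbit map, the contraction spans -/

section Operator

variable (K : Type*) [CommRing K] {V : Type*} [AddCommGroup V] [Module K V] (L : Submodule K V)

/-- the parameter space `W = L × Ann(L)`. -/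
abbrev W : Type _ := ↥L × ↥(L.dualAnnihilator)

/-- `op (ℓ, θ) = (z ↦ ℓ ∧ z + θ ⌟ z)`. -/
noncomputable def op : W K L →ₗ[K] Module.End K (ExteriorAlgebra K V) where
  toFun w := LinearMap.mulLeft K (ι K (w.1 : V)) + contractLeft (w.2 : Module.Dual K V)
  map_add' w w' := by
    refine LinearMap.ext fun z => ?_
    simp only [Prod.fst_add, Prod.snd_add, Submodule.coe_add, map_add, LinearMap.add_apply,
      LinearMap.mulLeft_apply, add_mul]
    abel
  map_smul' c w := by
    refine LinearMap.ext fun z => ?_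
    simp only [Prod.smul_fst, Prod.smul_snd, Submodule.coe_smul, map_smul, LinearMap.add_apply,
      LinearMap.smul_apply, LinearMap.mulLeft_apply, smul_mul_assoc, RingHom.id_apply, smul_add]

/-- `op w z = w.1 ∧ z + w.2 ⌟ z`. -/
lemma op_apply (w : W K L) (z : ExteriorAlgebra K V) :
    op K L w z = ι K (w.1 : V) * z + contractLeft (w.2 : Module.Dual K V) z := rfl

/-- the operators square to zero because `θ(ℓ) = 0`. -/
lemma op_mul_op (w : W K L) : op K L w * op K L w = 0 := by
  refine LinearMap.ext fun z => ?_
  have hθℓ : (w.2 : Module.Dual K V) (w.1 : V) = 0 :=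
    (Submodule.mem_dualAnnihilator (w.2 : Module.Dual K V)).mp w.2.2 _ w.1.2
  rw [Module.End.mul_apply, LinearMap.zero_apply, op_apply, op_apply, mul_add, ← mul_assoc,
    ExteriorAlgebra.ι_sq_zero, zero_mul, zero_add, map_add, CliffordAlgebra.contractLeft_contractLeft, add_zero,
    CliffordAlgebra.contractLeft_ι_mul, hθℓ, zero_smul, zero_sub, add_neg_cancel]

/-- the algebra map `ρ : Λ W → End(Λ V)` (universal property of the exterior algebra). -/
noncomputable def ρ : ExteriorAlgebra K (W K L) →ₐ[K] Module.End K (ExteriorAlgebra K V) :=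
  ExteriorAlgebra.lift K ⟨op K L, op_mul_op K L⟩

/-- `ρ` on a generator `w` is the operator `op w`. -/
lemma ρ_ι (w : W K L) : ρ K L (ι K w) = op K L w := by
  unfold ρ
  simp only [ExteriorAlgebra.lift_ι_apply]

/-- the orbit map of a vacuum `ω`: `Φ_ω a = ρ(a) ω`. -/
noncomputable def Φ (ω : ExteriorAlgebra K V) : ExteriorAlgebra K (W K L) →ₗ[K] ExteriorAlgebra K V where
  toFun a := ρ K L a ω
  map_add' a b := by rw [map_add, LinearMap.add_apply]
  map_smul' c a := by rw [map_smul, LinearMap.smul_apply, RingHom.id_apply]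

/-- `Φ ω a = ρ a ω`. -/
lemma Φ_apply (ω : ExteriorAlgebra K V) (a : ExteriorAlgebra K (W K L)) : Φ K L ω a = ρ K L a ω := rfl

/-- `Φ_ω` is `𝒜`-linear. -/
lemma Φ_mul (ω : ExteriorAlgebra K V) (c a : ExteriorAlgebra K (W K L)) :
    Φ K L ω (c * a) = ρ K L c (Φ K L ω a) := by
  rw [Φ_apply, Φ_apply, map_mul, Module.End.mul_apply]

/-- evaluation at `x` after `ρ`. -/
noncomputable def evρ (x : ExteriorAlgebra K V) : ExteriorAlgebra K (W K L) →ₗ[K] ExteriorAlgebra K V where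
  toFun a := ρ K L a x
  map_add' a b := by rw [map_add, LinearMap.add_apply]
  map_smul' c a := by rw [map_smul, LinearMap.smul_apply, RingHom.id_apply]

/-- `evρ x a = ρ a x`. -/
lemma evρ_apply (x : ExteriorAlgebra K V) (a : ExteriorAlgebra K (W K L)) : evρ K L x a = ρ K L a x := rfl

/-- the degree-`k` contraction span `S_k(x) = ρ(Λ^k W) · x`. -/
noncomputable def S (k : ℕ) (x : ExteriorAlgebra K V) : Submodule K (ExteriorAlgebra K V) :=
  (⋀[K]^k (W K L)).map (evρ K L x)

/-- the wedge-model map `θ ↦ θ ∧ v` on `Λ^k W`. -/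
noncomputable def wedge (k : ℕ) (v : ExteriorAlgebra K (W K L)) :
    (⋀[K]^k (W K L)) →ₗ[K] ExteriorAlgebra K (W K L) :=
  (LinearMap.mulRight K v) ∘ₗ (⋀[K]^k (W K L)).subtype

/-- **BRIDGE (structure form):** the contraction span of `Φ_ω(v)` is the `Φ_ω`-image of the wedge-model range. -/
theorem S_Φ_eq (k : ℕ) (ω : ExteriorAlgebra K V) (v : ExteriorAlgebra K (W K L)) :
    S K L k (Φ K L ω v) = (LinearMap.range (wedge K L k v)).map (Φ K L ω) := by
  rw [S, wedge, LinearMap.range_comp, Submodule.range_subtype, ← Submodule.map_comp]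
  congr 1
  refine LinearMap.ext fun a => ?_
  rw [evρ_apply, LinearMap.comp_apply, LinearMap.mulRight_apply, ← Φ_mul, Φ_apply]

end Operator

/-! ### 2b. Ranks (over a field) -/

section Rank

variable {K : Type*} [Field K] {V : Type*} [AddCommGroup V] [Module K V] {L : Submodule K V}

/-- **BRIDGE (rank form):** if `Φ_ω` is injective, `dim S_k(Φ_ω v)` is the wedge-model rank of `v` in degree `k`. -/
theorem finrank_S_eq_of_injective {ω : ExteriorAlgebra K V} (hΦ : Function.Injective (Φ K L ω)) (k : ℕ)
    (v : ExteriorAlgebra K (W K L)) :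
    Module.finrank K (S K L k (Φ K L ω v)) = Module.finrank K (LinearMap.range (wedge K L k v)) := by
  rw [S_Φ_eq]
  exact (LinearEquiv.finrank_eq (Submodule.equivMapOfInjective _ hΦ _)).symm

/-- **INJECTIVITY CRITERION (socle):** for any basis `bW` of `W` indexed by a finite linear order,
`Φ_ω` is injective as soon as `Φ_ω(top monomial) ≠ 0`. -/
theorem Φ_injective_of_top {I : Type*} [LinearOrder I] [Fintype I] (bW : Basis I K (W K L))
    {ω : ExteriorAlgebra K V} (htop : Φ K L ω (BB bW Finset.univ) ≠ 0) : Function.Injective (Φ K L ω) :=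
  injective_of_map_top_ne_zero bW (Φ K L ω) (fun c y => ρ K L c y) (fun _ => map_zero _)
    (fun c a => Φ_mul K L ω c a) htop

/-- the two together. -/
theorem finrank_S_eq {I : Type*} [LinearOrder I] [Fintype I] (bW : Basis I K (W K L))
    {ω : ExteriorAlgebra K V} (htop : Φ K L ω (BB bW Finset.univ) ≠ 0) (k : ℕ) (v : ExteriorAlgebra K (W K L)) :
    Module.finrank K (S K L k (Φ K L ω v)) = Module.finrank K (LinearMap.range (wedge K L k v)) :=
  finrank_S_eq_of_injective (Φ_injective_of_top bW htop) k v

end Rank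

/-! ### 2c. `Λ V` is the FREE rank-one `Λ W`-module on a good vacuum (dimension count) -/

section Free

variable {K : Type*} [Field K] {V : Type*} [AddCommGroup V] [Module K V] [FiniteDimensional K V]
  {L : Submodule K V}

omit [FiniteDimensional K V] in
/-- `dim ⋀M = 2^{#I}` for a module with a basis indexed by `I`. -/
lemma finrank_exteriorAlgebra_eq {M : Type*} [AddCommGroup M] [Module K M] {I : Type*} [LinearOrder I]
    [Fintype I] (bM : Basis I K M) : Module.finrank K (ExteriorAlgebra K M) = 2 ^ Fintype.card I := by
  rw [Module.finrank_eq_card_basis bM.ExteriorAlgebra, Fintype.card_finset]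

variable (L) in
/-- `dim W = dim L + dim Ann L = dim V`. -/
lemma finrank_W : Module.finrank K (W K L) = Module.finrank K V := by
  haveI : Module.Free K ↥L := Module.Free.of_divisionRing K ↥L
  haveI : Module.Free K ↥L.dualAnnihilator := Module.Free.of_divisionRing K ↥L.dualAnnihilator
  rw [Module.finrank_prod]
  exact Subspace.finrank_add_finrank_dualAnnihilator_eq L

variable (L) in
omit [FiniteDimensional K V] in
/-- `W` is free (a vector space). -/
lemma free_W : Module.Free K (W K L) := Module.Free.of_divisionRing K (W K L)

variable (L) in
/-- `W` is finite-dimensional. -/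
lemma finite_W : Module.Finite K (W K L) := inferInstance

/-- **FREENESS:** if `Φ_ω(top) ≠ 0` then `Φ_ω : Λ W → Λ V` is a linear BIJECTION (injective by the socle lemma,
and `dim Λ W = 2 ^ dim W = 2 ^ dim V = dim Λ V`). -/
theorem Φ_bijective_of_top {I : Type*} [LinearOrder I] [Fintype I] (bW : Basis I K (W K L))
    {ω : ExteriorAlgebra K V} (htop : Φ K L ω (BB bW Finset.univ) ≠ 0) : Function.Bijective (Φ K L ω) := by
  have hinj := Φ_injective_of_top bW htop
  let bV := Module.finBasis K V
  haveI : Module.Finite K (ExteriorAlgebra K (W K L)) := Module.Finite.of_basis (BB bW)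
  haveI : Module.Finite K (ExteriorAlgebra K V) := Module.Finite.of_basis bV.ExteriorAlgebra
  have hdim : Module.finrank K (ExteriorAlgebra K (W K L)) = Module.finrank K (ExteriorAlgebra K V) := by
    rw [finrank_exteriorAlgebra_eq bW, finrank_exteriorAlgebra_eq bV, Fintype.card_fin,
      ← Module.finrank_eq_card_basis bW, finrank_W]
  exact ⟨hinj, (LinearMap.injective_iff_surjective_of_finrank_eq_finrank hdim).mp hinj⟩

/-- the resulting identification `Λ W ≃ Λ V` (as `K`-spaces; it is `Λ W`-linear by `Φ_mul`). -/
noncomputable def Φequiv {I : Type*} [LinearOrder I] [Fintype I] (bW : Basis I K (W K L))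
    {ω : ExteriorAlgebra K V} (htop : Φ K L ω (BB bW Finset.univ) ≠ 0) :
    ExteriorAlgebra K (W K L) ≃ₗ[K] ExteriorAlgebra K V :=
  LinearEquiv.ofBijective (Φ K L ω) (Φ_bijective_of_top bW htop)

/-- the linear equivalence `Φequiv` is `Φ ω` as a function. -/
lemma Φequiv_apply {I : Type*} [LinearOrder I] [Fintype I] (bW : Basis I K (W K L))
    {ω : ExteriorAlgebra K V} (htop : Φ K L ω (BB bW Finset.univ) ≠ 0) (a : ExteriorAlgebra K (W K L)) :
    Φequiv bW htop a = Φ K L ω a := rfl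

/-- **BRIDGE for EVERY class `x ∈ Λ V`:** its degree-`k` contraction rank is the wedge-model rank of its
preimage `Φ_ω⁻¹(x) ∈ Λ W` (HankelRank / KunnethRank / PointPairRank compute the right-hand side). -/
theorem finrank_S_eq_wedge {I : Type*} [LinearOrder I] [Fintype I] (bW : Basis I K (W K L))
    {ω : ExteriorAlgebra K V} (htop : Φ K L ω (BB bW Finset.univ) ≠ 0) (k : ℕ) (x : ExteriorAlgebra K V) :
    Module.finrank K (S K L k x) =
      Module.finrank K (LinearMap.range (wedge K L k ((Φequiv bW htop).symm x))) := by
  conv_lhs => rw [← (Φequiv bW htop).apply_symm_apply x, Φequiv_apply]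
  exact finrank_S_eq bW htop k _

end Free

/-! ### 3. `S_2(x)` is LITERALLY the tree's `ContractionSpan.span ↑L ↑(Ann L) x` -/

section Tree

variable (K : Type*) [CommRing K] {V : Type*} [AddCommGroup V] [Module K V] (L : Submodule K V)

omit L in
/-- `ιMulti 2 w = ι (w 0) * ι (w 1)` over a `CommRing` (th-7's text; the tree's `ContractionSpan.ιMulti_two` in `ContractionSpanAlgebra.lean` is the same identity stated over a field — kept here verbatim so the carrier-bridge sections stay under `[CommRing K]`). -/
lemma ιMulti_two {M : Type*} [AddCommGroup M] [Module K M] (w : Fin 2 → M) :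
    ExteriorAlgebra.ιMulti K 2 w = ι K (w 0) * ι K (w 1) := by
  rw [ExteriorAlgebra.ιMulti_apply]
  simp [List.ofFn_succ]

/-- `ρ` of a product of two generators, expanded (four terms, the `⌟⌟` term with its sign). -/
lemma ρ_ι_mul_ι (w₁ w₂ : W K L) (x : ExteriorAlgebra K V) :
    ρ K L (ι K w₁ * ι K w₂) x =
      ι K (w₁.1 : V) * (ι K (w₂.1 : V) * x) + ι K (w₁.1 : V) * contractLeft (w₂.2 : Module.Dual K V) x
        - ι K (w₂.1 : V) * contractLeft (w₁.2 : Module.Dual K V) x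
        + contractLeft (w₁.2 : Module.Dual K V) (contractLeft (w₂.2 : Module.Dual K V) x) := by
  have hθℓ : (w₁.2 : Module.Dual K V) (w₂.1 : V) = 0 :=
    (Submodule.mem_dualAnnihilator (w₁.2 : Module.Dual K V)).mp w₁.2.2 _ w₂.1.2
  rw [map_mul, Module.End.mul_apply, ρ_ι, ρ_ι, op_apply, op_apply, mul_add, map_add,
    CliffordAlgebra.contractLeft_ι_mul, hθℓ, zero_smul, zero_sub]
  abel

/-- `S 2 x` is LITERALLY the tree's `ContractionSpan.span L L.dualAnnihilator x`. -/
theorem S_two_eq (x : ExteriorAlgebra K V) :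
    S K L 2 x = Summit.Ventures.HSemireg.ContractionSpan.span (L : Set V) (L.dualAnnihilator : Set (Module.Dual K V)) x := by
  apply le_antisymm
  · -- `Λ² W` is spanned by the `ι w₁ * ι w₂`
    rw [S, ← ExteriorAlgebra.ιMulti_span_fixedDegree, Submodule.map_span, Submodule.span_le]
    rintro _ ⟨_, ⟨w, rfl⟩, rfl⟩
    rw [evρ_apply, ιMulti_two, ρ_ι_mul_ι]
    refine Submodule.add_mem _ (Submodule.sub_mem _ (Submodule.add_mem _ ?_ ?_) ?_) ?_
    · exact Submodule.subset_span (Or.inl (Or.inl ⟨_, (w 0).1.2, _, (w 1).1.2, rfl⟩))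
    · exact Submodule.subset_span (Or.inl (Or.inr ⟨_, (w 0).1.2, _, (w 1).2.2, rfl⟩))
    · exact Submodule.subset_span (Or.inl (Or.inr ⟨_, (w 1).1.2, _, (w 0).2.2, rfl⟩))
    · exact Submodule.subset_span (Or.inr ⟨_, (w 0).2.2, _, (w 1).2.2, rfl⟩)
  · rw [Summit.Ventures.HSemireg.ContractionSpan.span, Submodule.span_le]
    have mem : ∀ w₁ w₂ : W K L,
        ι K (w₁.1 : V) * (ι K (w₂.1 : V) * x) + ι K (w₁.1 : V) * contractLeft (w₂.2 : Module.Dual K V) x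
          - ι K (w₂.1 : V) * contractLeft (w₁.2 : Module.Dual K V) x
          + contractLeft (w₁.2 : Module.Dual K V) (contractLeft (w₂.2 : Module.Dual K V) x) ∈ S K L 2 x :=
      fun w₁ w₂ => by
        rw [← ρ_ι_mul_ι]
        exact ⟨ι K w₁ * ι K w₂, Summit.Ventures.HSemireg.ContractionSpan.ι_mul_ι_mem_two _ _, rfl⟩
    rintro y ((⟨q₁, hq₁, q₂, hq₂, rfl⟩ | ⟨q, hq, θ, hθ, rfl⟩) | ⟨θ₁, hθ₁, θ₂, hθ₂, rfl⟩)
    · simpa using mem (⟨q₁, hq₁⟩, 0) (⟨q₂, hq₂⟩, 0)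
    · simpa using mem (⟨q, hq⟩, 0) (0, ⟨θ, hθ⟩)
    · simpa using mem (0, ⟨θ₁, hθ₁⟩) (0, ⟨θ₂, hθ₂⟩)

end Tree

end Summit.Ventures.HSemireg.WedgeBridge
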